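import Literature.Geometry.Lorentzian.FinalState
import Literature.Geometry.Lorentzian.TameGenericityDiagonal

/-!
# Route PhotonSphereChannels · crux `TameCensorship` (stmt-FinalStateConjecture-17431) · line `Sketch`, skeleton v4 ·
# stub `stub_pathOfRobust`: robust escapability ⇒ a compactly supported admissible path of good small members

Helper file (`--supports stmt-FinalStateConjecture-17431`) of the reshaped line `Sketch` (lead c1, 2026-08-17); the second
of its three Lean-sized glue stubs. From the ROBUST (enrichment-stable) escapability of an abstract property `Q` at an
admissible datum `d` it extracts what the tame packaging needs: a jointly smooth path through `d` of admissible data,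
supported on one compact set, with `Q`-good members for small non-zero parameters. Finite-dimensional bookkeeping over
`IsSmoothDataFamily.comp_contDiff`; no definition is introduced (the registered stub signature inlines the probe legend of
route `RobustClausewiseGenericity`).

Reference: D. Christodoulou, CQG 16 (1999) A23, p. A24.
-/

set_option linter.dupNamespace false

open Literature.Geometry.Lorentzian
open scoped Manifold ContDiff Topology
open Filter Set Function

noncomputable section

namespace Summit.FinalStateConjecture.FinalStateConjecture.Theorems.PhotonSphereChannels.TameCensorshipUnwind

/-- **Stub `stub_pathOfRobust` of line `Sketch` (skeleton v4) for the crux `PhotonSphereChannels.TameCensorship`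
(stmt-FinalStateConjecture-17431): a robustly escapable property yields a compactly supported admissible PATH of good small
members.** If `Q` is robustly escapable at the admissible datum `d` (every compactly supported smooth admissible probe
through `d` enriches to one along all of whose further enrichments an open dense set of radial directions has `Q` for
all small non-zero parameters), then there is a jointly smooth one-parameter family `G : ℝ¹ → data` through `d`, with
admissible members agreeing with `d` (both fundamental forms, pointwise) off ONE compact set, whose members with
`0 < ‖c‖ < ε` satisfy `Q`: enrich the constant `0`-parameter probe, take the trivial further enrichment, pick any direction
`v` of the (non-empty) open dense escape set and set `G c := G₁ ((c 0) • v)`. No injectivity or immersion is claimed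
(that is the gauge shear's business, `stub_shearInjImm` / `stub_witnessOfGoodPath`). [Christodoulou 1999, p. A24: the
families `α₀ + λ f`.] -/
theorem stub_pathOfRobust :
    ∀ (X : Type) [TopologicalSpace X] [ChartedSpace E3 X] [IsManifold (𝓡 3) ∞ X] [T2Space X]
    [SecondCountableTopology X] [ConnectedSpace X] (d : InitialDataSet (𝓡 3) X) (Q : InitialDataSet
    (𝓡 3) X → Prop), d ∈ admissibleVacuumData X → (∀ (m : ℕ) (G : EuclideanSpace ℝ (Fin m) →
    InitialDataSet (𝓡 3) X), (InitialDataSet.IsSmoothDataFamily m G ∧ G 0 = d ∧ (∀ c, G c ∈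
    admissibleVacuumData X) ∧ ∃ K : Set X, IsCompact K ∧ ∀ c, ∀ x ∉ K, (G c).h.inner x = d.h.inner x
    ∧ (G c).k x = d.k x) → ∃ (n : ℕ) (G₁ : EuclideanSpace ℝ (Fin n) → InitialDataSet (𝓡 3) X) (L :
    EuclideanSpace ℝ (Fin m) →ₗ[ℝ] EuclideanSpace ℝ (Fin n)), Function.Injective L ∧
    (InitialDataSet.IsSmoothDataFamily n G₁ ∧ G₁ 0 = d ∧ (∀ c, G₁ c ∈ admissibleVacuumData X) ∧ ∃ K
    : Set X, IsCompact K ∧ ∀ c, ∀ x ∉ K, (G₁ c).h.inner x = d.h.inner x ∧ (G₁ c).k x = d.k x) ∧ (∀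
    c, G₁ (L c) = G c) ∧ ∀ (p : ℕ) (G₂ : EuclideanSpace ℝ (Fin p) → InitialDataSet (𝓡 3) X) (L' :
    EuclideanSpace ℝ (Fin n) →ₗ[ℝ] EuclideanSpace ℝ (Fin p)), Function.Injective L' →
    (InitialDataSet.IsSmoothDataFamily p G₂ ∧ G₂ 0 = d ∧ (∀ c, G₂ c ∈ admissibleVacuumData X) ∧ ∃ K
    : Set X, IsCompact K ∧ ∀ c, ∀ x ∉ K, (G₂ c).h.inner x = d.h.inner x ∧ (G₂ c).k x = d.k x) → (∀
    c, G₂ (L' c) = G₁ c) → ∃ U : Set (EuclideanSpace ℝ (Fin p)), IsOpen U ∧ Dense U ∧ ∀ v ∈ U, ∃ δ :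
    ℝ, 0 < δ ∧ ∀ t : ℝ, t ≠ 0 → |t| < δ → Q (G₂ (t • v))) → ∃ G : EuclideanSpace ℝ (Fin 1) →
    InitialDataSet (𝓡 3) X, InitialDataSet.IsSmoothDataFamily 1 G ∧ G 0 = d ∧ (∀ c, G c ∈
    admissibleVacuumData X) ∧ (∃ K : Set X, IsCompact K ∧ ∀ c, ∀ x ∉ K, (G c).h.inner x = d.h.inner
    x ∧ (G c).k x = d.k x) ∧ ∃ ε : ℝ, 0 < ε ∧ ∀ c, c ≠ 0 → ‖c‖ < ε → Q (G c) := by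
  intro X _ _ _ _ _ _ d Q hd hR
  obtain ⟨n, G₁, L, -, hT₁, -, hR₁⟩ := hR 0 (fun _ => d)
    ⟨InitialDataSet.isSmoothDataFamily_const 0 d, rfl, fun _ => hd, ∅, isCompact_empty,
      fun _ _ _ => ⟨rfl, rfl⟩⟩
  obtain ⟨U, -, hUd, hU⟩ := hR₁ n G₁ LinearMap.id (fun a b h => h) hT₁ (fun c => rfl)
  obtain ⟨v, hv⟩ := hUd.nonempty
  obtain ⟨δ, hδ, hgood⟩ := hU v hv
  obtain ⟨hG₁s, hG₁0, hG₁a, K, hK, hG₁K⟩ := hT₁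
  have hπ : ContDiff ℝ ∞ (fun c : EuclideanSpace ℝ (Fin 1) => (c 0) • v) :=
    (EuclideanSpace.proj (𝕜 := ℝ) (ι := Fin 1) 0).contDiff.smul contDiff_const
  refine ⟨fun c => G₁ ((c 0) • v), hG₁s.comp_contDiff hπ, ?_, fun c => hG₁a _,
    ⟨K, hK, fun c x hx => hG₁K _ x hx⟩, δ, hδ, fun c hc hcδ => ?_⟩
  · show G₁ (((0 : EuclideanSpace ℝ (Fin 1)) 0) • v) = d
    rw [PiLp.zero_apply, zero_smul]
    exact hG₁0
  · have hc0 : c 0 ≠ 0 := by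
      intro h0
      apply hc
      ext i
      fin_cases i
      simpa using h0
    have hle : |c 0| ≤ ‖c‖ := by simpa [Real.norm_eq_abs] using PiLp.norm_apply_le c 0
    exact hgood (c 0) hc0 (hle.trans_lt hcδ)

end Summit.FinalStateConjecture.FinalStateConjecture.Theorems.PhotonSphereChannels.TameCensorshipUnwind

end
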